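import Mathlib
import Summits.Ventures.PercRepro2.Defs
import Summits.Ventures.PercRepro2.Harris
import Summits.Ventures.PercRepro2.Graph
import Summits.Ventures.PercRepro2.Events
import Summits.Ventures.PercRepro2.TReduction
import Summits.Ventures.PercRepro2.TReductionBase
import Summits.Ventures.PercRepro2.THAntipodalCoef
import Summits.Ventures.PercRepro2.THAntipodalPair
import Summits.Ventures.PercRepro2.THSignomialCert
import Summits.Ventures.PercRepro2.THBaseEnum
import Summits.Ventures.PercRepro2.THClassVEnum
import Summits.Ventures.PercRepro2.THClassVPlusGraph
import Summits.Ventures.PercRepro2.THClassVPlusEnum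
import Summits.Ventures.PercRepro2.THClassVPlusSliceA
import Summits.Ventures.PercRepro2.THClassVPlusSliceB
import Summits.Ventures.PercRepro2.THClassVPlusSliceC
import Summits.Ventures.PercRepro2.THClassVPlusSliceD
import Summits.Ventures.PercRepro2.THClassVPlusSliceE
import Summits.Ventures.PercRepro2.THClassVPlusSliceF
import Summits.Ventures.PercRepro2.THClassVPlusSliceG
import Summits.Ventures.PercRepro2.THClassVPlusSliceH
import Summits.Ventures.PercRepro2.THClassVPlusSliceI
import Summits.Ventures.PercRepro2.THClassVPlusSliceJ
import Summits.Ventures.PercRepro2.THClassVPlusSliceK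
import Summits.Ventures.PercRepro2.THClassVPlusSliceL
import Summits.Ventures.PercRepro2.THClassVPlusSliceM
import Summits.Ventures.PercRepro2.THClassVPlusSliceN
import Summits.Ventures.PercRepro2.THClassVPlusSliceO
import Summits.Ventures.PercRepro2.THClassVPlusSliceP

/-!
# (T_h) holds on `G₅⁺` (class (v) plus `r–h`) at the tight pair, for every weight vector — the
relative (signomial) certificate at work (mine-a g50)

On `G₅⁺` = the class-(v) graph with the extra edge `r–h` (`THClassVPlusGraph`), at the pair
`(𝓤, 𝓥) = ({x₆ ∈ T}, {x₄, x₅ ∈ T})`, the main antipodal base case is `1 ≥ 0`, but the PROPER pinned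
base case «`r–h` closed, the rest free» is `G₅`'s main case `−2`: the one-pair certificate of
`THAntipodalPair` (which repairs a negative MAIN case) does not apply, and neither does the
termwise route.  `THSignomialCert.tform_nonneg_of_triples` does: the negative pattern
`(D₀, a₀) = (E ∖ {r–h}, r–h closed)` with weight `−2` is matched to the antipodal pair of pinnings
of `S = {r x₄, r x₅}` relative to it (`r x₄` closed / `r x₅` open and the reverse, `r–h` still
closed), each with weight `κ = 1`; the two partners have base case `1 ≥ κ`, every other pinning
has base case `≥ 0` (the kernel census `THClassVPlusSliceA`–`P`, `3^{11} − 2` patterns), so the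
matched weight is at most the base case everywhere (`Lsum_le_kform`) and (T_h) holds for every
admissible weight vector (`t_classVPlus`, `t_classVPlus_explicit`).  By the subgraph transport of
`THExtension` this is strictly stronger than `THClassV.t_classV`.  No instance, no notation.
-/

namespace Summit.Ventures.PercRepro2

namespace THClassVPlus

open Finset TReduction THBaseEnum THAntipodalPair THSignomial

section Census

/-- **The census**: every pinning pattern other than «`r–h` closed, the rest free» has a
nonnegative base case (the slices `THClassVPlusSliceA`–`P` and `enum_main`). -/
theorem enum_nonneg (s0 s1 s2 s3 s4 s5 s6 s7 s8 s9 s10 : Fin 3)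
    (hneg : ¬ (s0 = 2 ∧ s1 = 2 ∧ s2 = 2 ∧ s3 = 2 ∧ s4 = 2 ∧ s5 = 2 ∧ s6 = 2 ∧ s7 = 2 ∧ s8 = 2 ∧
      s9 = 2 ∧ s10 = 0)) :
    0 ≤ enum s0 s1 s2 s3 s4 s5 s6 s7 s8 s9 s10 := by
  rcases fin3_cases s0 with rfl | rfl | rfl
  · rcases fin3_cases s1 with rfl | rfl | rfl
    · rcases fin3_cases s2 with rfl | rfl | rfl
      · exact slice_000 s3 s4 s5 s6 s7 s8 s9 s10
      · exact slice_001 s3 s4 s5 s6 s7 s8 s9 s10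
      · exact slice_002 s3 s4 s5 s6 s7 s8 s9 s10
    · rcases fin3_cases s2 with rfl | rfl | rfl
      · exact slice_010 s3 s4 s5 s6 s7 s8 s9 s10
      · exact slice_011 s3 s4 s5 s6 s7 s8 s9 s10
      · exact slice_012 s3 s4 s5 s6 s7 s8 s9 s10
    · rcases fin3_cases s2 with rfl | rfl | rfl
      · exact slice_020 s3 s4 s5 s6 s7 s8 s9 s10
      · exact slice_021 s3 s4 s5 s6 s7 s8 s9 s10
      · rcases fin3_cases s3 with rfl | rfl | rfl
        · exact slice_0220 s4 s5 s6 s7 s8 s9 s10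
        · exact slice_0221 s4 s5 s6 s7 s8 s9 s10
        · exact slice_0222 s4 s5 s6 s7 s8 s9 s10
  · rcases fin3_cases s1 with rfl | rfl | rfl
    · rcases fin3_cases s2 with rfl | rfl | rfl
      · exact slice_100 s3 s4 s5 s6 s7 s8 s9 s10
      · exact slice_101 s3 s4 s5 s6 s7 s8 s9 s10
      · exact slice_102 s3 s4 s5 s6 s7 s8 s9 s10
    · rcases fin3_cases s2 with rfl | rfl | rfl
      · exact slice_110 s3 s4 s5 s6 s7 s8 s9 s10
      · exact slice_111 s3 s4 s5 s6 s7 s8 s9 s10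
      · exact slice_112 s3 s4 s5 s6 s7 s8 s9 s10
    · rcases fin3_cases s2 with rfl | rfl | rfl
      · exact slice_120 s3 s4 s5 s6 s7 s8 s9 s10
      · exact slice_121 s3 s4 s5 s6 s7 s8 s9 s10
      · rcases fin3_cases s3 with rfl | rfl | rfl
        · exact slice_1220 s4 s5 s6 s7 s8 s9 s10
        · exact slice_1221 s4 s5 s6 s7 s8 s9 s10
        · exact slice_1222 s4 s5 s6 s7 s8 s9 s10
  · rcases fin3_cases s1 with rfl | rfl | rfl
    · rcases fin3_cases s2 with rfl | rfl | rfl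
      · exact slice_200 s3 s4 s5 s6 s7 s8 s9 s10
      · exact slice_201 s3 s4 s5 s6 s7 s8 s9 s10
      · rcases fin3_cases s3 with rfl | rfl | rfl
        · exact slice_2020 s4 s5 s6 s7 s8 s9 s10
        · exact slice_2021 s4 s5 s6 s7 s8 s9 s10
        · exact slice_2022 s4 s5 s6 s7 s8 s9 s10
    · rcases fin3_cases s2 with rfl | rfl | rfl
      · exact slice_210 s3 s4 s5 s6 s7 s8 s9 s10
      · exact slice_211 s3 s4 s5 s6 s7 s8 s9 s10
      · rcases fin3_cases s3 with rfl | rfl | rfl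
        · exact slice_2120 s4 s5 s6 s7 s8 s9 s10
        · exact slice_2121 s4 s5 s6 s7 s8 s9 s10
        · exact slice_2122 s4 s5 s6 s7 s8 s9 s10
    · rcases fin3_cases s2 with rfl | rfl | rfl
      · rcases fin3_cases s3 with rfl | rfl | rfl
        · exact slice_2200 s4 s5 s6 s7 s8 s9 s10
        · exact slice_2201 s4 s5 s6 s7 s8 s9 s10
        · exact slice_2202 s4 s5 s6 s7 s8 s9 s10
      · rcases fin3_cases s3 with rfl | rfl | rfl
        · exact slice_2210 s4 s5 s6 s7 s8 s9 s10
        · exact slice_2211 s4 s5 s6 s7 s8 s9 s10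
        · exact slice_2212 s4 s5 s6 s7 s8 s9 s10
      · rcases fin3_cases s3 with rfl | rfl | rfl
        · exact slice_2220 s4 s5 s6 s7 s8 s9 s10
        · exact slice_2221 s4 s5 s6 s7 s8 s9 s10
        · rcases fin3_cases s4 with rfl | rfl | rfl
          · exact slice_22220 s5 s6 s7 s8 s9 s10
          · exact slice_22221 s5 s6 s7 s8 s9 s10
          · rcases fin3_cases s5 with rfl | rfl | rfl
            · exact slice_222220 s6 s7 s8 s9 s10
            · exact slice_222221 s6 s7 s8 s9 s10
            · rcases fin3_cases s6 with rfl | rfl | rfl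
              · exact slice_2222220 s7 s8 s9 s10
              · exact slice_2222221 s7 s8 s9 s10
              · rcases fin3_cases s7 with rfl | rfl | rfl
                · exact slice_22222220 s8 s9 s10
                · exact slice_22222221 s8 s9 s10
                · rcases fin3_cases s8 with rfl | rfl | rfl
                  · exact slice_222222220 s9 s10
                  · exact slice_222222221 s9 s10
                  · rcases fin3_cases s9 with rfl | rfl | rfl
                    · exact slice_2222222220 s10
                    · exact slice_2222222221 s10
                    · rcases fin3_cases s10 with rfl | rfl | rfl
                      · exact absurd ⟨rfl, rfl, rfl, rfl, rfl, rfl, rfl, rfl, rfl, rfl, rfl⟩ hneg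
                      · exact slice_22222222221
                      · rw [enum_main]; decide

end Census

section Match

variable {R : Type*} [Field R] [LinearOrder R] [IsStrictOrderedRing R]

/-- The pinning pattern of a pinned base case `(D', a')`: free on `D'`, the state of `a'` off
`D'`. -/
def patOf {n : ℕ} (D' : Finset (Fin n)) (a' : Config (Fin n)) : Fin n → Fin 3 :=
  fun x => if x ∈ D' then 2 else if a' x then 1 else 0

omit [IsStrictOrderedRing R] in
/-- **A base point matches a pinned pattern iff its `stateOf` pattern is the pattern.** -/
lemma match_iff {n : ℕ} (D' : Finset (Fin n)) (a' : Config (Fin n)) (D : Finset (Fin n))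
    (a₀ : Fin n → R) (h01 : ∀ x, x ∉ D → a₀ x = 0 ∨ a₀ x = 1) :
    (D = D' ∧ ∀ x, x ∉ D → a₀ x = if a' x then 1 else 0) ↔ stateOf D a₀ = patOf D' a' := by
  constructor
  · rintro ⟨rfl, h⟩
    funext x
    unfold stateOf patOf
    by_cases hx : x ∈ D
    · simp [hx]
    · rw [if_neg hx, if_neg hx, h x hx]
      cases a' x <;> simp
  · intro heq
    have hD : D = D' := by
      ext x
      constructor
      · intro hx
        have := congrFun heq x
        unfold stateOf patOf at this
        rw [if_pos hx] at this
        by_contra hx'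
        rw [if_neg hx'] at this
        split_ifs at this <;> exact absurd this (by decide)
      · intro hx'
        by_contra hx
        have := congrFun heq x
        unfold stateOf patOf at this
        rw [if_neg hx, if_pos hx'] at this
        split_ifs at this <;> exact absurd this (by decide)
    refine ⟨hD, fun x hx => ?_⟩
    have hx' : x ∉ D' := hD ▸ hx
    have := congrFun heq x
    unfold stateOf patOf at this
    rw [if_neg hx, if_neg hx'] at this
    rcases h01 x hx with h0 | h1
    · rw [h0] at this ⊢
      rw [if_neg zero_ne_one] at this
      rcases Bool.eq_false_or_eq_true (a' x) with hb | hb <;> rw [hb] at this ⊢ <;>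
        simp at this ⊢
    · rw [h1] at this ⊢
      rw [if_pos rfl] at this
      rcases Bool.eq_false_or_eq_true (a' x) with hb | hb <;> rw [hb] at this ⊢ <;>
        simp at this ⊢

end Match

section Certificate

variable {R : Type*} [Field R] [LinearOrder R] [IsStrictOrderedRing R]

/-- The edge set of the negative pattern: every edge but `r–h`. -/
def D₀ : Finset (Fin 11) := univ.erase 10

/-- The pinned state of the negative pattern: `r–h` closed. -/
def a₀ : Config (Fin 11) := fun _ => false

/-- The edges pinned by the relative antipodal pair: `r x₄`, `r x₅`. -/
def S₀ : Finset (Fin 11) := {2, 3}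

/-- The partner pattern on `S₀`: `r x₄` closed, `r x₅` open. -/
def b₀ : Config (Fin 11) := fun x => decide (x = 3)

/-- The three patterns of the certificate, as vectors. -/
lemma patOf_neg : patOf D₀ a₀ = ![2, 2, 2, 2, 2, 2, 2, 2, 2, 2, 0] := by
  funext i; fin_cases i <;> decide

/-- The first partner. -/
lemma patOf_cert : patOf (D₀ \ S₀) (overwrite S₀ a₀ b₀) = ![2, 2, 0, 1, 2, 2, 2, 2, 2, 2, 0] := by
  funext i; fin_cases i <;> decide

/-- The second partner. -/
lemma patOf_cert' :
    patOf (D₀ \ S₀) (overwrite S₀ a₀ fun x => !b₀ x) = ![2, 2, 1, 0, 2, 2, 2, 2, 2, 2, 0] := by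
  funext i; fin_cases i <;> decide

/-- A pattern equal to `![2, …, 2, 0]` has those entries. -/
lemma entries_of_eq_neg (t : Fin 11 → Fin 3) (h : t = ![2, 2, 2, 2, 2, 2, 2, 2, 2, 2, 0]) :
    t 0 = 2 ∧ t 1 = 2 ∧ t 2 = 2 ∧ t 3 = 2 ∧ t 4 = 2 ∧ t 5 = 2 ∧ t 6 = 2 ∧ t 7 = 2 ∧ t 8 = 2 ∧
      t 9 = 2 ∧ t 10 = 0 := by
  subst h
  decide

/-- A pattern with those entries is `![2, …, 2, 0]`. -/
lemma eq_neg_of_entries (t : Fin 11 → Fin 3)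
    (h : t 0 = 2 ∧ t 1 = 2 ∧ t 2 = 2 ∧ t 3 = 2 ∧ t 4 = 2 ∧ t 5 = 2 ∧ t 6 = 2 ∧ t 7 = 2 ∧ t 8 = 2 ∧
      t 9 = 2 ∧ t 10 = 0) : t = ![2, 2, 2, 2, 2, 2, 2, 2, 2, 2, 0] := by
  obtain ⟨h0, h1, h2, h3, h4, h5, h6, h7, h8, h9, h10⟩ := h
  funext i
  fin_cases i
  · exact h0
  · exact h1
  · exact h2
  · exact h3
  · exact h4
  · exact h5
  · exact h6
  · exact h7
  · exact h8
  · exact h9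
  · exact h10

/-- **The matched weight is at most the base case, at every base point**: `hbase` of the
signomial certificate with `J = Unit`, `w = −2`, `κ = 1`. -/
theorem Lsum_le_kform (D : Finset (Fin 11)) (a : Fin 11 → R) (_ha : IsProbVec a)
    (h01 : ∀ x, x ∉ D → a x = 0 ∨ a x = 1) :
    Lsum (triW (fun _ : Unit => (-2 : R)) fun _ => 1) (triD (fun _ => D₀) fun _ => S₀)
        (triA (fun _ => S₀) (fun _ => a₀) fun _ => b₀) D a ≤ kform Q U e D a := by
  rw [Lsum_base _ _ _ D a h01, kform_eq_enum D a h01, Fintype.sum_sum_type, Fintype.sum_sum_type,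
    Fintype.sum_unique, Fintype.sum_unique, Fintype.sum_unique]
  simp only [match_iff (triD (fun _ : Unit => D₀) (fun _ => S₀) (Sum.inl default))
      (triA (fun _ : Unit => S₀) (fun _ => a₀) (fun _ => b₀) (Sum.inl default)) D a h01,
    match_iff (triD (fun _ : Unit => D₀) (fun _ => S₀) (Sum.inr (Sum.inl default)))
      (triA (fun _ : Unit => S₀) (fun _ => a₀) (fun _ => b₀) (Sum.inr (Sum.inl default))) D a h01,
    match_iff (triD (fun _ : Unit => D₀) (fun _ => S₀) (Sum.inr (Sum.inr default)))
      (triA (fun _ : Unit => S₀) (fun _ => a₀) (fun _ => b₀) (Sum.inr (Sum.inr default))) D a h01]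
  simp only [triW, triD, triA, Sum.elim_inl, Sum.elim_inr, patOf_neg, patOf_cert, patOf_cert']
  generalize ht : stateOf D a = t
  by_cases h0 : t = ![2, 2, 2, 2, 2, 2, 2, 2, 2, 2, 0]
  · rw [if_pos h0, if_neg (by rw [h0]; decide), if_neg (by rw [h0]; decide), h0]
    show (-2 : R) + (0 + 0) ≤ ((enum 2 2 2 2 2 2 2 2 2 2 0 : ℤ) : R)
    rw [enum_neg]; norm_num
  by_cases h1 : t = ![2, 2, 0, 1, 2, 2, 2, 2, 2, 2, 0]
  · rw [if_neg h0, if_pos h1, if_neg (by rw [h1]; decide), h1]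
    show (0 : R) + (1 + 0) ≤ ((enum 2 2 0 1 2 2 2 2 2 2 0 : ℤ) : R)
    rw [enum_cert]; norm_num
  by_cases h2 : t = ![2, 2, 1, 0, 2, 2, 2, 2, 2, 2, 0]
  · rw [if_neg h0, if_neg h1, if_pos h2, h2]
    show (0 : R) + (0 + 1) ≤ ((enum 2 2 1 0 2 2 2 2 2 2 0 : ℤ) : R)
    rw [enum_cert']; norm_num
  rw [if_neg h0, if_neg h1, if_neg h2]
  simp only [add_zero]
  exact Int.cast_nonneg (enum_nonneg _ _ _ _ _ _ _ _ _ _ _ fun h => h0 (eq_neg_of_entries t h))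

/-- **THEOREM.** (T_h) holds on `G₅⁺` at the pair `({x₆ ∈ T}, {x₄, x₅ ∈ T})` for every admissible
weight vector: `P(Q ∩ U) P(e) + P(Q ∩ e) P(U) ≤ P(Q ∩ U ∩ e) + P(Q) P(U ∩ e)`. -/
theorem t_classVPlus (p : Fin 11 → R) (hp : IsProbVec p) :
    prob p (Q ∩ U) * prob p e + prob p (Q ∩ e) * prob p U ≤
      prob p (Q ∩ U ∩ e) + prob p Q * prob p (U ∩ e) :=
  tform_nonneg_of_triples Q U e (fun _ : Unit => (-2 : R)) (fun _ => 1) (fun _ => D₀) (fun _ => S₀)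
    (fun _ => a₀) (fun _ => b₀) (fun _ => by decide) (fun _ => zero_le_one) (fun _ => by norm_num)
    (fun D a h h01 => Lsum_le_kform D a h h01) p hp

/-- **THEOREM (explicit form).** (T_h) on `G₅⁺` with `s = r = 0`, `h = 1`, `𝓤 = {x₆ ∈ T}`,
`𝓥 = {x₄, x₅ ∈ T}`, in the form of `THRefutation.not_t_general`. -/
theorem t_classVPlus_explicit (p : Fin 11 → R) (hp : IsProbVec p) :
    prob p (clusterInEvent ends 0 {T : Set (Fin 7) | (1 : Fin 7) ∈ T} ∩ clusterInEvent ends 0 𝓤)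
        * prob p (clusterInEvent ends 0 𝓥)
      + prob p (clusterInEvent ends 0 {T : Set (Fin 7) | (1 : Fin 7) ∈ T} ∩ clusterInEvent ends 0 𝓥)
        * prob p (clusterInEvent ends 0 𝓤) ≤
      prob p (clusterInEvent ends 0 {T : Set (Fin 7) | (1 : Fin 7) ∈ T} ∩ clusterInEvent ends 0 𝓤
          ∩ clusterInEvent ends 0 𝓥)
        + prob p (clusterInEvent ends 0 {T : Set (Fin 7) | (1 : Fin 7) ∈ T})
          * prob p (clusterInEvent ends 0 𝓤 ∩ clusterInEvent ends 0 𝓥) :=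
  t_classVPlus p hp

/-- The negative proper pinned base case: `r–h` closed, the rest free — `G₅`'s main case. -/
theorem kform_neg_eq : kform Q U e D₀ (pinA a₀ : Fin 11 → R) = -2 := by
  rw [kform_eq_enum D₀ _ (fun x _ => pinA_zero_or_one a₀ x)]
  have : stateOf D₀ (pinA a₀ : Fin 11 → R) = ![2, 2, 2, 2, 2, 2, 2, 2, 2, 2, 0] := by
    funext i
    fin_cases i <;> simp [stateOf, D₀, pinA, a₀]
  rw [this]
  show ((enum 2 2 2 2 2 2 2 2 2 2 0 : ℤ) : R) = -2
  rw [enum_neg]; norm_num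

end Certificate

end THClassVPlus

end Summit.Ventures.PercRepro2
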